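import Mathlib
import HarnessLib
import HarnessLib.Audit
import Summits.RiemannHypothesis.Statement
import Literature.NumberTheory.LFunctions.WeilExplicit
import Literature.NumberTheory.LFunctions.RiemannXi
import Literature.NumberTheory.LFunctions.RiemannXiProofs
import Literature.Analysis.Complex.Hurwitz
import HarnessLib.Audit.Status.Attr

/-!
Route: WeilGroundState

DORMANT since 2026-08-25T04:47:33Z (reconciler: no traction for 7.4 d (last activity item-evidence-added at 2026-08-17T19:01:49Z); parked, not closed — `ledger route dormant route-RiemannHypothesis-WeilGroundState --off` to reactivate) — unstaffed, not closed; items shared with open routes are served there. `ledger route dormant <id> --off` reactivates.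

Route WeilGroundState — Perron–Frobenius for the Weil ground state (card
weil-ground-state-perron-frobenius).

THESIS X (words). It suffices to show: (X1) for every window a > 0 the bottom ε(a) of Weil's
quadratic form Q(g) = Re W(g ⋆ g̃) restricted to test functions supported in [−a, a] is a SIMPLE,
ISOLATED eigenvalue whose eigenfunction is EVEN (t ↦ −t); and (X2) along some sequence of windows
a_k → ∞ the L²-normalised ground states u_k, suitably rescaled, have Mellin–Laplace transforms c_k ·
weilMellin u_k converging to Riemann's ξ locally uniformly on the open critical strip. Given X1, the
theorem of Connes–van Suijlekom (CMP 2025, Thm 1.2/6.1; filed here as the crux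
GroundStateMellinRealZeros in the tree's normalisation) puts every zero of weilMellin u_k on Re s =
1/2; X2 and Hurwitz's theorem (in the tree) then force every zero of ξ in the strip onto the line,
i.e. RH.

X (Lean, decls of this route; every constant elaborated in Sketch.lean, lean check rc 0):
GroundStateSimpleEven ∧ GroundStatesConvergeToXi, where
  GroundStateSimpleEven := ∀ a > 0, ∃ φ δ, 0 < δ ∧ ∀ g, IsWeilTest g → tsupport g ⊆ Icc (−a) a →
∫‖g‖² = 1 → (g odd ∨ (g even ∧ ∫ conj φ · g = 0)) → weilGroundEnergy a + δ ≤ (weilQuadratic g).re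
  GroundStatesConvergeToXi := ∃ a_k → ∞, ∃ ground states u_k (MemLp 2, L²-limits of normalised
minimising sequences of test functions on [−a_k, a_k]), ∃ c_k ≠ 0, TendstoLocallyUniformlyOn (k, s ↦
c_k * weilMellin (u_k) s) riemannXi atTop {s | 0 < s.re ∧ s.re < 1}
(constants: Literature.NumberTheory.LFunctions.{IsWeilTest, weilQuadratic, weilGroundEnergy,
weilMellin, riemannXi}, MeasureTheory.MemLp, TendstoLocallyUniformlyOn, Summit.RiemannHypothesis).
Ground states are encoded WITHOUT positing an operator: u is a ground state at window a iff it is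
the L²-limit of an L²-normalised minimising sequence of test functions (closed forms are lower
semicontinuous, so Q̄(u) = ε(a) and u is a bottom eigenvector of the Friedrichs realisation;
conversely test functions are a form core).

ASSEMBLY: GroundStateSimpleEven → GroundStateMellinRealZeros → GroundStatesConvergeToXi →
Summit.RiemannHypothesis (Hurwitz on U = {1/2 < Re s < 1}; ξ ≢ 0; ξ(1−s) = ξ(s);
riemannXi_eq_zero_iff_holds). No separate Target decl is filed: X is the conjunction of the rank-2
and rank-3 cruxes and a rank-0 copy would only duplicate their inline predicates ahead of the wanted
definitions.

Rationale: WHY THIS LINE (operator theory / Markov processes brought to bear on Weil positivity). Connes–van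
Suijlekom [ConnesSuijlekom2025 = arXiv:2511.23257, Thm 1.2/6.1] prove: if the bottom of the
truncated Weil form at window a is simple, isolated and EVEN, the Fourier transform of the ground
state has only real zeros (a continuum Carathéodory–Fejér theorem); Connes [Connes2026Letter =
arXiv:2602.04022, §6.6] names exactly this hypothesis, plus convergence of the ground states to 𝓔(h)
(Fact 6.4 for the prolate guess k_λ), as the remaining steps of his strategy, after which Hurwitz
gives RH. The card's import from probability/operator theory: the geometric side of the explicit
formula on a window is a killed pure-jump DIRICHLET FORM minus a constant plus the parity-diagonal
rank-(1,1) pole form P = 2|⟨g,cosh(t/2)⟩|² − 2|⟨g,sinh(t/2)⟩|² (jump rates Λ(n)n^{-1/2} ≥ 0 at ±log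
n, archimedean density e^{−|h|/2}/(1−e^{−2|h|}) > 0: Haran doi:10.1007/BF01231521, card
weil-levy-generator). Beurling–Deny + Krein–Rutman/Jentzsch (Reed–Simon XIII.44) make the Markov
ground state simple, strictly positive and even at EVERY window, with ⟨ψ₀, cosh(t/2)⟩ > 0 for free;
Aronszajn–Krein rank-one theory then reduces the C–vS hypothesis to one explicit secular inequality
E_even(a) < E_odd(a). Positivity of the primes, used as jump RATES, is the whole engine; numerics in
print are consistent (odd matrix σ⁻ has 'one less small eigenvalue', arXiv:2106.01715 §2.5) but the
odd sector has never been probed directly (arXiv:2605.20224 §10: 'even sector only').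

RANKED CRUXES. #2 GroundStateSimpleEven — ∀ a > 0 the bottom is simple, isolated, even (junk-free
variational form: odd normalised test functions, and even ones orthogonal to a witness φ, lie ≥
ε(a)+δ). The card's claim and the informative experiment. #3 GroundStatesConvergeToXi — Connes' step
(ii): c_k · weilMellin u_k → ξ locally uniformly on the open strip along a_k → ∞; carries the
RH-content (false under ¬RH given #2, #4). #4 GroundStateMellinRealZeros — C–vS Thm 6.1 in the
tree's normalisation (window [−a,a] ↔ [0,2a], evenness t ↦ −t ↔ x ↦ L−x, trig-polynomial core ↔
C_c^∞ core); theorem in print, dictionary to prove; cite request filed to vendor it as a fact. #5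
ArchimedeanWindowSimpleEven — #2 at a = (log 2)/2, a finite certified computation next to the proved
kernel certificate weilPositivityOn_log_two_half_holds; cheapest place for the mechanism to die.
SUPPORT (unranked): MarkovPartPositiveGroundState (the PF half, provable now: positive even ground
state of the pole-removed form, every minimising sequence converges to it mod phases);
SmallWindowsSimpleEven (∃ a₀, #2 for a ≤ a₀ by rescaling to the log-symbol shape operator: pole
pushes are O(a), parity gap is scale-free).

KILL CRITERIA. (i) A kit computation (trig-basis Galerkin blocks σ± of arXiv:2106.01715 §2.2, N ≈
100–200, mpmath) exhibiting one window a ≤ 1.5 with odd bottom ≤ even bottom, or a degenerate even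
bottom, refutes #2 and #5 as stated — the route then either restates #2 on an unbounded set of
windows (enough for the assembly with #3 restricted to those windows) or closes, recording that
parity must be imposed by hand in Connes' programme. (ii) A proof that #3 fails for every
normalisation c_k under ¬RH is expected (it is the RH-content) and is NOT a kill; a proof that #3
fails even under RH (ground states do not converge to 𝓔(h)) closes the route. (iii) If the C–vS
dictionary (#4) breaks because their one-sided distribution D on [0,L] (Remark 4.3) does not
reproduce weilFunctional on trig polynomials, restate #4 with the corrected form or vendor their
operator as a posited object.

NOT DECOMPOSED YET. No operator A_a, no Dirichlet-form API, no prolate functions are posited as Lean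
objects (definition requests filed: IsWeilGroundState, weilMarkovForm); #2 is not split into 'PF
gap' × 'secular inequality' until #5 or the numerics say which way the competition goes; #3 is not
split into 'Fact 6.4 for k_λ' + 'θ_x ≈ k_λ' until #2 closes; no rung beyond the archimedean window;
the Collatz–Wielandt bonus lemma of the card belongs to card weil-comb-cone-schur-threshold and is
not filed here.

Novelty: NOVELTY — nearest prior art (searched and READ): ConnesSuijlekom2025 = arXiv:2511.23257 =
doi:10.1007/s00220-025-05493-1 (Thm 1.2/6.1: simple isolated EVEN ground state ⇒ real zeros;
simplicity/evenness ASSUMED; pp.3,6,7,11 read: proof uses form-core density + finite sections Thm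
5.6 + Hurwitz; no Perron–Frobenius/Jentzsch/Krein–Rutman anywhere, grep 0); Connes2026Letter =
arXiv:2602.04022 §6.1–6.6, §7.4 (read pp.20–25: hypothesis named as THE remaining step beside θ_x ≈
k_λ; suggests the prolate commuting-operator analogy instead; Fact 6.4; A_λ has compact resolvent);
ConnesConsani2023 = arXiv:2106.01715 §2.2–2.5 (read p.8–10: even/odd blocks σ±, pole terms rank one
in each block, 'odd matrix: one less small eigenvalue'); arXiv:2605.20224 (2026, read pp.6,7,18,20:
even sector only diagonalised for ζ, 'odd-sector zero not probed'; for χ₃ the odd block is strictly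
positive while the even bottom dips); Bombieri2000 (variational theory of ε(a): minimisers,
Euler–Lagrange; no parity/multiplicity theorem); Haran 1990 doi:10.1007/BF01231521 (local terms of
the explicit formula as Riesz potentials / Markov generators). DELTA: a different, a-uniform
MECHANISM for the open C–vS hypothesis — Beurling–Deny/Krein–Rutman on the Markov part of the
windowed explicit formula (complete for that half: support item) + Aronszajn–Krein through the
parity-diagonal pole form, leaving one explicit secular inequality per window (crux #2) — assembled
with C–vS and Hurwitz into a kernel-checkable route  [refs: 10.1007/s00220-025-05493-1, 10.1007/BF01231521, 2511.23257, 2602.04022, 2106.01715, 2605.20224, doi:10.1007/s00220-025-05493-1, doi:10.1007/BF01231521, ConnesSuijlekom2025, ConnesConsani2023, Bombieri2000]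

Barriers (technique_class: Weil-positivity Perron-Frobenius rank-one-perturbation): BARRIERS (catalogue Literature/Barriers/RiemannHypothesis, 21 entries examined; technique_class
below).
- Literature.Barriers.RiemannHypothesis.DeBrangesPositivity: not engaged — no positivity stronger
than Weil's is claimed; crux #2 is about the SHAPE (parity, multiplicity) of the minimiser,
meaningful whether or not ε(a) ≥ 0, and C–vS's conclusion (real zeros of û_a) is RH-free; the
Conrey–Li counterexamples concern de Branges' conditions (3.1)/(3.3), which nothing here asserts.
- Literature.Barriers.RiemannHypothesis.NewmanConjecture: consistent — Λ ≥ 0 forbids a margin and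
none is produced: under RH both sector bottoms tend to 0⁺ super-exponentially (ε ~ 1−χ₂(λ),
arXiv:2602.04022 §6.4) and #2 claims only their ORDER plus simplicity, never a uniform gap; the
RH-content sits in the convergence crux #3, exactly where a no-margin statement must sit.
- Literature.Barriers.RiemannHypothesis.BerryKeatingOperator: not engaged — the self-adjoint
operator here is the Friedrichs realisation of the truncated Weil form; its GROUND STATE is one
function whose Mellin zeros approximate zeta zeros; no claim 'spectrum = zeros', no xp-quantisation,
zeros arise as roots of û via C–vS.
- Literature.Barriers.RiemannHypothesis.ScalingSystemCounting: not engaged — no level-counting /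
Weyl-law matching of eigenvalues with zeros is asserted anywhere in the route.
- Literature.Barriers.RiemannHypothesis.PseudoLaplacianSpacing: not engaged — no automorphic
pseudo-Laplacian and no identification of s

Novelty grade: variant — GEN-2 novelty audit of the thesis (its card regraded new-combination -> variant today). The NOVELTY paragraph's delta - 'a different, a-uniform MECHANISM: Beurling-Deny/Krein-Rutman on the Markov part of the windowed explicit formula (complete for that half)' - is IN PRINT since June 2026 (arXiv API (refuter refuter-novelty-audit-RiemannHypothesis-RiemannHypothesis-15-g2-0, 2026-08-15T13:26:52Z; prior: arXiv:2606.09096 (Suzuki, June 2026, READ pp.2-5 + sec.5): Thm 1.4 = the route's SmallWindowsSimpleEven (small a: bottom positive, SIMPLE, EVEN) proved by the route's own mechanism (Beurling-Deny Dirichlet form, irreducible jump kernel, positivity improving, parity); Thm 1.1, Thm 1.3, arXiv:2511.23257 (Connes-van Suijlekom 2025 Thm 1.2/6.1) + arXiv:2602.04022 sec.6.6 + arXiv:2511.22755 (CCM25): ta)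

History (route lifecycle, newest last):
- 2026-08-25T04:47:33Z · DORMANT — reconciler: no traction for 7.4 d (last activity item-evidence-added at 2026-08-17T19:01:49Z); parked, not closed — `ledger route dormant route-RiemannHypothesi (operator:999:3720797)

sub-problem: RiemannHypothesis · status: dormant · opened planner-plancard-RiemannHypothesis-RiemannHyp-10de63da-0 2026-08-15T10:57:10Z · rev 3 · ledger route-RiemannHypothesis-WeilGroundState
GENERATED by the gate from the ledger (D-0016/17). Provers cite these decls: `theorem foo : Summit.RiemannHypothesis.RiemannHypothesis.Theses.WeilGroundState.<Decl> := …` in Summits/RiemannHypothesis/RiemannHypothesis/Theorems/<Name>.lean.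
-/

namespace Summit.RiemannHypothesis.RiemannHypothesis.Theses.WeilGroundState

open scoped BigOperators Topology Manifold Classical MeasureTheory ProbabilityTheory Matrix InnerProductSpace ComplexConjugate ContinuousMap
open Filter Set Function TopologicalSpace MeasureTheory

attribute [summit_statement] _root_.Summit.RiemannHypothesis

open Summit

/-- item stmt-RiemannHypothesis-1526 · crux · rank 2 · open · by planner
why it might fail: ∀a tolerates no parity level crossing (codim 1 in a); for a ≥ 0.75 both sector bottoms are <1e-11 (super-exp. decay, Connes2026Letter §6.4): their ORDER at large a is unprobed; proved only for a ≤ 1/100 (Suzuki Thm 1.4); even-simplicity is open even for finite Galerkin matrices (zenodo.20737111).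
sources: ConnesConsaniMoscovici2025, ConnesSuijlekom2025, Connes2026Letter, Suzuki2026, ConnesConsani2023, arXiv:2605.20224
[crux] For every window a>0 the bottom ε(a)=weilGroundEnergy a of Weil's form Q(g)=Re weilQuadratic
g on test functions supported in [-a,a] is a SIMPLE, ISOLATED eigenvalue with EVEN eigenfunction —
stated variationally and junk-free: some φ (the ground state) and δ>0 such that every L²-normalised
ODD test function, and every L²-normalised EVEN test function orthogonal to φ, has Re Q ≥ ε(a)+δ.
Since Q is parity-block-diagonal (W is even) and test functions are a form core, this is equivalent
to: odd-sector bottom > ε(a) = even-sector bottom, and second even level > ε(a) — exactly the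
hypothesis of Connes–van Suijlekom Thm 6.1 (ConnesSuijlekom2025 = arXiv:2511.23257) named in
Connes2026Letter (arXiv:2602.04022) §6.6 as a remaining step. Mechanism (card
weil-ground-state-perron-frobenius): Q = 𝓔_a − M_a‖·‖² + P with 𝓔_a a killed pure-jump Dirichlet
form (rates Λ(n)n^{-1/2} at jumps ±log n, archimedean density e^{-|h|/2}/(1−e^{-2|h|})) and P = 2|∫g
cosh(t/2)|² − 2|∫g sinh(t/2)|² parity-diagonal of signature (1,1); Krein–Rutman/Jentzsch for the
Markov part (support item MarkovPartPositiveGroundState: simple, positive, even ψ₀ with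
⟨ψ₀,cosh(t/2)⟩>0) + Aronszajn–Krein secular equations i -/
@[route_item "route-RiemannHypothesis-WeilGroundState", crux]
def GroundStateSimpleEven : Prop :=
  ∀ a : ℝ, 0 < a → ∃ φ : ℝ → ℂ, ∃ δ : ℝ, 0 < δ ∧ ∀ g : ℝ → ℂ, Literature.NumberTheory.LFunctions.IsWeilTest g → tsupport g ⊆ Icc (-a) a → ∫ t, ‖g t‖ ^ 2 = (1 : ℝ) → ((∀ t, g (-t) = -g t) ∨ ((∀ t, g (-t) = g t) ∧ ∫ t, starRingEnd ℂ (φ t) * g t = 0)) → Literature.NumberTheory.LFunctions.weilGroundEnergy a + δ ≤ (Literature.NumberTheory.LFunctions.weilQuadratic g).re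

/-- item stmt-RiemannHypothesis-1527 · crux · rank 3 · open · by planner
why it might fail: Carries RH: with GroundStateSimpleEven + C–vS it implies RH, so it is false under ¬RH; even under RH it is CCM25 §7's conjectural limit formula and needs Connes' Fact 6.4 for k_λ plus 'k_λ ≈ ξ_λ' (CCM25 §8 missing step 2) in a norm controlling û on substrips — both open in print.
sources: ConnesConsaniMoscovici2025, arXiv:2511.22755, Connes2026Letter, arXiv:2602.04022, Suzuki2026, arXiv:2606.09096
[crux] Connes' step (ii) in the tree's normalisation: along SOME sequence of windows a_k → ∞ there
are L²-normalised ground states u_k (MemLp 2; L²-limits of normalised minimising sequences of test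
functions on [−a_k,a_k], hence bottom eigenvectors of the Friedrichs realisation) and constants c_k
≠ 0 with c_k · weilMellin u_k → riemannXi locally uniformly on the open critical strip {0<Re s<1}.
Since weilMellin u (1/2+iz) = û(z), this is 'û_k → Ξ on |Im z|<1/2' — cf. Connes2026Letter Fact 6.4
(proved for the prolate guess k_λ = 𝓔(h_λ), uniformly on closed substrips) and §6.6/§7.4 ('it
remains to show that k_λ is a sufficiently good approximation of θ_x'). Locally uniform on the OPEN
strip is the weakest form that feeds Hurwitz. This crux carries the RH-content of the line: with
GroundStateSimpleEven and GroundStateMellinRealZeros it implies RH, so under ¬RH it is false (an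
off-line zero at height γ, offset η, is visible to the minimiser only for a ≳ (log log γ)/(2η); card
weil-ladder-adversary). Attack: Connes' prolate/Sonin near-radical vectors (arXiv:2106.01715 §3;
Connes2026Letter §6.3–6.5) + a quantitative spectral-gap argument (the second even level stays ≳
1−|χ|-scale above th -/
@[route_item "route-RiemannHypothesis-WeilGroundState", crux]
def GroundStatesConvergeToXi : Prop :=
  ∃ a : ℕ → ℝ, ∃ u : ℕ → ℝ → ℂ, ∃ c : ℕ → ℂ, Tendsto a atTop atTop ∧ (∀ k, 0 < a k ∧ c k ≠ 0 ∧ MemLp (u k) 2 ∧ ∃ g : ℕ → ℝ → ℂ, (∀ n, Literature.NumberTheory.LFunctions.IsWeilTest (g n) ∧ tsupport (g n) ⊆ Icc (-(a k)) (a k) ∧ ∫ t, ‖g n t‖ ^ 2 = (1 : ℝ)) ∧ Tendsto (fun n => (Literature.NumberTheory.LFunctions.weilQuadratic (g n)).re) atTop (𝓝 (Literature.NumberTheory.LFunctions.weilGroundEnergy (a k))) ∧ Tendsto (fun n => ∫ t, ‖g n t - u k t‖ ^ 2) atTop (𝓝 0)) ∧ TendstoLocallyUniformlyOn (fun k s =>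 c k * Literature.NumberTheory.LFunctions.weilMellin (u k) s) Literature.NumberTheory.LFunctions.riemannXi atTop {s : ℂ | 0 < s.re ∧ s.re < 1}

/-- item stmt-RiemannHypothesis-1528 · support · rank 4 · closed · proved by Summit.RiemannHypothesis.RiemannHypothesis.Theorems.groundStateMellinRealZeros_proof @ f52c5c033eea (prover) · by planner
why it might fail: Known theorem, but AS STATED it needs a dictionary: C–vS build Q on trig polynomials of [0,L] from a ONE-SIDED distribution D (Rem. 4.3: symmetrising loses δ′-terms) and assume ess. self-adjointness; a mismatch with the closure from C_c^∞(−a,a) or with weilArchTerm's finite part breaks the transfer.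
sources: ConnesSuijlekom2025, arXiv:2511.23257, Connes2026Letter, Literature.NumberTheory.LFunctions.Connes2026_weilGroundState_zeros_re_eq_half_holds
[crux] Connes–van Suijlekom Thm 6.1 (ConnesSuijlekom2025 = arXiv:2511.23257, Thm 1.2/6.1; proof
p.11) transferred to the tree's normalisation: at a window a>0 where the bottom is simple, isolated
and even (hypothesis = the window-a clause of GroundStateSimpleEven), every ground state u (MemLp 2,
L²-limit of a normalised minimising sequence of test functions on [−a,a]; by lower semicontinuity of
the closed form u is a normalised bottom eigenvector, unique up to phase and a.e. even) has ENTIRE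
Mellin–Laplace transform weilMellin u (u ∈ L² vanishes a.e. off [−a,a]) all of whose zeros lie on Re
s = 1/2 (their 'ξ̂ has only real zeros', s = 1/2+iz). THEOREM IN PRINT modulo a dictionary the
prover must establish: (i) window [−a,a] ↔ their [0,L], L = 2a; evenness t↦−t ↔ x↦L−x (footnote to
Thm 6.1); (ii) their hermitian form ⟨f|g⟩_Q = D̃(f^* * g) on trigonometric polynomials of [0,L], D =
Weil's distribution restricted to [0,2a] (polar density 2cosh(y/2); −Σ Λ(n)n^{-1/2} δ_{log n};
archimedean finite part of e^{y/2}/(2 sinh y) with the −(log 4π+γ)δ₀/2 normalisation of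
weilArchTermBombieri) agrees with weilFunctional(g ⋆ f̃), and trig polynomials cut off to the window
are a form core of the -/
@[route_item "route-RiemannHypothesis-WeilGroundState", crux]
def GroundStateMellinRealZeros : Prop :=
  ∀ a : ℝ, 0 < a → (∃ φ : ℝ → ℂ, ∃ δ : ℝ, 0 < δ ∧ ∀ g : ℝ → ℂ, Literature.NumberTheory.LFunctions.IsWeilTest g → tsupport g ⊆ Icc (-a) a → ∫ t, ‖g t‖ ^ 2 = (1 : ℝ) → ((∀ t, g (-t) = -g t) ∨ ((∀ t, g (-t) = g t) ∧ ∫ t, starRingEnd ℂ (φ t) * g t = 0)) → Literature.NumberTheory.LFunctions.weilGroundEnergy a + δ ≤ (Literature.NumberTheory.LFunctions.weilQuadratic g).re) → ∀ u : ℝ → ℂ, MemLp u 2 → (∃ g : ℕ → ℝ → ℂ, (∀ n, Literature.NumberTheory.LFunctions.IsWeilTest (g n) ∧ tsupport (g n) ⊆ Icc (-a) a ∧ ∫ t, ‖g n t‖ ^ 2 = (1 : ℝ)) ∧ Tendsto (fun n => (Literature.NumberTheory.LFunctions.weilQuadratic (g n)).re) atTop (𝓝 (Literature.NumberTheory.LFunctions.weilGroundEnergy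 a)) ∧ Tendsto (fun n => ∫ t, ‖g n t - u t‖ ^ 2) atTop (𝓝 0)) → Differentiable ℂ (Literature.NumberTheory.LFunctions.weilMellin u) ∧ ∀ s : ℂ, Literature.NumberTheory.LFunctions.weilMellin u s = 0 → s.re = 1 / 2

/-- item stmt-RiemannHypothesis-1529 · support · rank 5 · closed · proved by Summit.RiemannHypothesis.RiemannHypothesis.Theorems.WeilGroundState.archimedeanWindowSimpleEven_proof @ 491d8905a554 (prover) · by planner
why it might fail: At a≈0.35 the even push-up 2|⟨ψ₀,cosh(t/2)⟩|² ≲ 4a ≈ 1.4 is of the order of the parity gap of the log-symbol operator on the window (Weyl heuristic log 2–log 3 before counting the digamma well at ξ=0): the odd bottom could already be the lower one here.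
sources: arXiv:2106.01715, Yoshida1992, Suzuki2026, Literature.NumberTheory.LFunctions.weilPositivityOn_log_two_half_holds
[crux] The window-a clause of GroundStateSimpleEven at the archimedean window a = (log 2)/2: no
prime enters (log n ≥ log 2 = 2a kills the prime term), the form is polar + digamma only — the same
window where the tree holds the kernel certificate
Literature.NumberTheory.LFunctions.weilPositivityOn_log_two_half_holds
(WeilPositivityCertificate*.lean). A FINITE CERTIFIED COMPUTATION: a Rayleigh–Ritz UPPER bound for
the even bottom from one even trial vector g₀ (then ε(a) ≤ Q(g₀)), and certified LOWER bounds ≥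
Q(g₀)+δ for (a) the odd block and (b) the even block compressed to φ^⊥ with φ = g₀ (Temple /
Lehmann–Goerisch, or a positive-definite minorant of the windowed kernel as in
WeilPositivityMinorant.lean); note the statement only needs lower bounds relative to ε(a) ≤ Q(g₀).
First rung of the parity ladder and the cheapest place where the mechanism can die; numerics first
(kit: blocks σ± of arXiv:2106.01715 §2.2 at L = log 2). -/
@[route_item "route-RiemannHypothesis-WeilGroundState"]
def ArchimedeanWindowSimpleEven : Prop :=
  ∃ φ : ℝ → ℂ, ∃ δ : ℝ, 0 < δ ∧ ∀ g : ℝ → ℂ, Literature.NumberTheory.LFunctions.IsWeilTest g → tsupport g ⊆ Icc (-(Real.log 2 / 2)) (Real.log 2 / 2) → ∫ t, ‖g t‖ ^ 2 = (1 : ℝ) → ((∀ t, g (-t) = -g t) ∨ ((∀ t, g (-t) = g t) ∧ ∫ t, starRingEnd ℂ (φ t) * g t = 0)) → Literature.NumberTheory.LFunctions.weilGroundEnergy (Real.log 2 / 2) + δ ≤ (Literature.NumberTheory.LFunctions.weilQuadratic g).re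

/-- item stmt-RiemannHypothesis-1530 · support · rank 9 · closed · proved by Summit.RiemannHypothesis.RiemannHypothesis.Theorems.markovPartPositiveGroundState_proof (prover) · by planner
sources: doi:10.5281/zenodo.20682834, Suzuki2026, arXiv:2606.09096, doi:10.1515/9783110218091, doi:10.1080/03605302.2019.1611851, doi:10.1007/BF01231521
[support] Perron–Frobenius half of the mechanism, provable now modulo textbook functional analysis.
Remove the pole form: Q₀(g) := Re weilQuadratic g − 2|∫ g(t)cosh(t/2)dt|² + 2|∫ g(t)sinh(t/2)dt|²
(polar term of g⋆g̃ is 2Re(ĝ(0)conj ĝ(1)) = 2|∫g cosh|² − 2|∫g sinh|²), so Q₀ = (−prime +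
archimedean)(g⋆g̃) = 𝓔_a(g) − M_a‖g‖² with 𝓔_a(g) = Σ_{log n<2a} Λ(n)n^{-1/2}‖g(·+log n)−g‖² + ∫₀^∞
e^{t/2}(2 sinh t)^{-1}‖g(·+t)−g‖² dt a killed pure-jump Dirichlet form on (−a,a) and M_a = 2Σ_{log
n<2a}Λ(n)n^{-1/2} + 2∫₀^∞(e^{t/2}−1)/(2 sinh t)dt + log 4π + γ (use k(t)+k(−t) = 2‖g‖² −
‖g(·+t)−g‖², k = g⋆g̃, in weilPrimeTerm and weilArchTermBombieri;
weilArchTermBombieri_eq_weilArchTerm). Beurling–Deny ⇒ positivity-preserving semigroup; archimedean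
jump density > 0 at every length ⇒ positivity IMPROVING; compact resolvent (symbol ~ log|ξ| → ∞;
Connes2026Letter §6.4 states it for A_λ, a rank-2 perturbation; cf. the logarithmic Laplacian,
Chen–Weth doi:10.1080/03605302.2019.1611851) ⇒ Reed–Simon XIII.44 / Jentzsch: the bottom of Q₀ is a
simple eigenvalue with an a.e. strictly positive eigenfunction u, even by reflection symmetry +
uniqueness, and EVERY normalised minimising sequence of test functions -/
@[route_item "route-RiemannHypothesis-WeilGroundState"]
def MarkovPartPositiveGroundState : Prop :=
  ∀ a : ℝ, 0 < a → ∃ u : ℝ → ℂ, MemLp u 2 ∧ (∀ t, u (-t) = u t) ∧ (∀ t ∈ Ioo (-a) a, 0 < (u t).re ∧ (u t).im = 0) ∧ ∀ g : ℕ → ℝ → ℂ, (∀ n, Literature.NumberTheory.LFunctions.IsWeilTest (g n) ∧ tsupport (g n) ⊆ Icc (-a) a ∧ ∫ t, ‖g n t‖ ^ 2 = (1 : ℝ)) → Tendsto (fun n => (Literature.NumberTheory.LFunctions.weilQuadratic (g n)).re - 2 * ‖∫ t, g n t * (Real.cosh (t / 2) : ℂ)‖ ^ 2 + 2 * ‖∫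 t, g n t * (Real.sinh (t / 2) : ℂ)‖ ^ 2) atTop (𝓝 (sInf {x : ℝ | ∃ h : ℝ → ℂ, Literature.NumberTheory.LFunctions.IsWeilTest h ∧ tsupport h ⊆ Icc (-a) a ∧ ∫ t, ‖h t‖ ^ 2 = (1 : ℝ) ∧ x = (Literature.NumberTheory.LFunctions.weilQuadratic h).re - 2 * ‖∫ t, h t * (Real.cosh (t / 2) : ℂ)‖ ^ 2 + 2 * ‖∫ t, h t * (Real.sinh (t / 2) : ℂ)‖ ^ 2})) → ∃ c : ℕ → ℂ, (∀ n, ‖c n‖ = 1) ∧ Tendsto (fun n => ∫ t, ‖c n * g n t - u t‖ ^ 2) atTop (𝓝 0)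

/-- item stmt-RiemannHypothesis-1531 · support · rank 9 · closed · proved by Summit.RiemannHypothesis.RiemannHypothesis.Theorems.smallWindowsSimpleEven_proof @ 651fbe8e1eb2 (prover) · by planner
sources: doi:10.1080/03605302.2019.1611851, arXiv:2511.23257, doi:10.1515/9783110218091
[support] Small-window regime of GroundStateSimpleEven: ∃ a₀>0 such that the window-a clause holds
for all 0<a≤a₀. Sketch: rescale t = a·y; a·ρ(a s) → 1/(2s) (ρ(t) = e^{t/2}/(2 sinh t)), so after
subtracting the constant 2∫_{2a}^∞ρ the Markov part converges to the scale-free shape operator h₀(G)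
= ∫₀² ‖G(·+s)−G‖²/(2s) ds killed outside (−1,1) (symbol ~ log|ξ|; cf. the logarithmic Laplacian,
Chen–Weth 2019), whose ground state is simple, positive, even with a parity gap γ₀ > 0 (PF at unit
scale, as in MarkovPartPositiveGroundState); the pole pushes are O(a) (2‖cosh(t/2)‖²_{L²(−a,a)} ≈
4a, 2‖sinh(t/2)‖² ≈ a³/3) and no prime enters for a < (log 2)/2; so for small a the even bottom
stays simple and below the odd bottom by γ₀ − O(a). Needs norm-resolvent (or Mosco) convergence of
the rescaled forms and upper semicontinuity of the parity gap. RH-free; the toy rung that exercises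
the PF machinery end to end. -/
@[route_item "route-RiemannHypothesis-WeilGroundState"]
def SmallWindowsSimpleEven : Prop :=
  ∃ a₀ : ℝ, 0 < a₀ ∧ ∀ a : ℝ, 0 < a → a ≤ a₀ → ∃ φ : ℝ → ℂ, ∃ δ : ℝ, 0 < δ ∧ ∀ g : ℝ → ℂ, Literature.NumberTheory.LFunctions.IsWeilTest g → tsupport g ⊆ Icc (-a) a → ∫ t, ‖g t‖ ^ 2 = (1 : ℝ) → ((∀ t, g (-t) = -g t) ∨ ((∀ t, g (-t) = g t) ∧ ∫ t, starRingEnd ℂ (φ t) * g t = 0)) → Literature.NumberTheory.LFunctions.weilGroundEnergy a + δ ≤ (Literature.NumberTheory.LFunctions.weilQuadratic g).re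

/-- item stmt-RiemannHypothesis-1532 · assembly · rank 1 · closed · proved by Summit.RiemannHypothesis.RiemannHypothesis.Theorems.weilGroundStateAssembly_proof @ 06d97619824e (prover) · by planner
[assembly] Take (a_k, u_k, c_k) from GroundStatesConvergeToXi; GroundStateSimpleEven at a_k
discharges the hypothesis of GroundStateMellinRealZeros, so F_k := c_k · weilMellin u_k is entire
and zero-free on U := {1/2 < Re s < 1} (open, convex ⇒ preconnected); F_k → riemannXi locally
uniformly on U (TendstoLocallyUniformlyOn.mono from the strip); Hurwitz
(Complex.hurwitz_eqOn_zero_or_forall_ne_zero, Literature/Analysis/Complex/Hurwitz.lean, filter atTop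
on ℕ is NeBot) ⇒ riemannXi ≡ 0 on U — impossible (differentiable_riemannXi, riemannXi_zero = 1/2,
identity theorem AnalyticOnNhd.eqOn_zero_of_preconnected_of_eventuallyEq_zero on ℂ) — or riemannXi
is zero-free on U; by riemannXi_one_sub it is then zero-free on {0 < Re s < 1/2} too, so every zero
of ξ with 0<Re s<1 has Re s = 1/2; RH follows from riemannXi_eq_zero_iff_holds (zeros of ξ = zeros
of ζ in the open strip) and Mathlib's RiemannHypothesis binder shape
(riemannXi_eq_zero_of_nontrivial). Pure bookkeeping once the three cruxes are in hand; imports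
Literature.Analysis.Complex.Hurwitz in the Theorems file. -/
@[route_item "route-RiemannHypothesis-WeilGroundState"]
def Assembly : Prop :=
  GroundStateSimpleEven → GroundStateMellinRealZeros → GroundStatesConvergeToXi → Summit.RiemannHypothesis

/-! D-0027 §2.1 — DECIDING THEOREM (planner-authored via `route open/edit --closes-file`; by planner-rbadge-RiemannHypothesis-WeilGroundSta-3551cc54-g2-0 2026-08-15T16:13:52Z):
its hypotheses are this route's items and its conclusion the sub-problem Statement (glue_lint), and it elaborates with this file. -/

/-- DECIDING THEOREM (D-0027 §2.1). Take `(a_k, u_k, c_k)` from `GroundStatesConvergeToXi`;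
`GroundStateSimpleEven` at `a_k` discharges the hypothesis of `GroundStateMellinRealZeros`, so
`F_k := c_k · weilMellin u_k` is entire with all zeros on `Re s = 1/2`, hence zero-free on
`U := {1/2 < Re s < 1}`; `F_k → ξ` locally uniformly on `U`; Hurwitz ⇒ `ξ ≡ 0` on `U` (excluded by
the identity theorem and `ξ(0) = 1/2`) or `ξ` is zero-free on `U`; with `ξ(1-s) = ξ(s)` and
`riemannXi_eq_zero_iff_holds` every nontrivial zero of `ζ` has `Re s = 1/2`. -/
@[closes "route-RiemannHypothesis-WeilGroundState"] theorem closes (h₁ : GroundStateSimpleEven) (h₂ : GroundStateMellinRealZeros)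
    (h₃ : GroundStatesConvergeToXi) : _root_.Summit.RiemannHypothesis := by
  classical
  obtain ⟨a, u, c, -, hk, hlim⟩ := h₃
  -- the approximants and their zeros
  have hF : ∀ k, Differentiable ℂ
      (fun s => c k * _root_.Literature.NumberTheory.LFunctions.weilMellin (u k) s) ∧
      ∀ s, c k * _root_.Literature.NumberTheory.LFunctions.weilMellin (u k) s = 0 → s.re = 1 / 2 := by
    intro k
    obtain ⟨hak, hck, hu, g, hg, hQ, hL2⟩ := hk k
    obtain ⟨hdiff, hzero⟩ := h₂ (a k) hak (h₁ (a k) hak) (u k) hu ⟨g, hg, hQ, hL2⟩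
    refine ⟨(differentiable_const (c k)).mul hdiff, fun s hs => hzero s ?_⟩
    rcases mul_eq_zero.1 hs with h | h
    · exact absurd h hck
    · exact h
  -- the right half of the open critical strip
  set U : Set ℂ := {s : ℂ | 1 / 2 < s.re ∧ s.re < 1} with hUdef
  have hUo : IsOpen U :=
    (isOpen_lt continuous_const Complex.continuous_re).inter
      (isOpen_lt Complex.continuous_re continuous_const)
  have hUc : Convex ℝ U := (convex_halfSpace_re_gt (1 / 2)).inter (convex_halfSpace_re_lt 1)
  have hlimU : TendstoLocallyUniformlyOn
      (fun k s => c k * _root_.Literature.NumberTheory.LFunctions.weilMellin (u k) s)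
      _root_.Literature.NumberTheory.LFunctions.riemannXi Filter.atTop U :=
    hlim.mono fun s hs => ⟨by linarith [hs.1], hs.2⟩
  have hFd : ∀ᶠ k in Filter.atTop, DifferentiableOn ℂ
      (fun s => c k * _root_.Literature.NumberTheory.LFunctions.weilMellin (u k) s) U :=
    Filter.Eventually.of_forall fun k => (hF k).1.differentiableOn
  have hFne : ∃ᶠ k in Filter.atTop, ∀ z ∈ U,
      c k * _root_.Literature.NumberTheory.LFunctions.weilMellin (u k) z ≠ 0 :=
    Filter.Frequently.of_forall fun k z hz hz0 => by
      have := (hF k).2 z hz0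
      linarith [hz.1]
  rcases Complex.hurwitz_eqOn_zero_or_forall_ne_zero hUo hUc.isPreconnected hFd hlimU hFne with
    hzero | hne
  · -- `ξ ≡ 0` on `U` is impossible
    exfalso
    have han : AnalyticOnNhd ℂ _root_.Literature.NumberTheory.LFunctions.riemannXi Set.univ :=
      _root_.Literature.NumberTheory.LFunctions.differentiable_riemannXi.differentiableOn.analyticOnNhd
        isOpen_univ
    have hz₀ : ((3 : ℂ) / 4) ∈ U := by
      refine ⟨?_, ?_⟩ <;> norm_num
    have hev : _root_.Literature.NumberTheory.LFunctions.riemannXi =ᶠ[nhds ((3 : ℂ) / 4)] 0 :=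
      Filter.eventuallyEq_of_mem (hUo.mem_nhds hz₀) hzero
    have hall := han.eqOn_zero_of_preconnected_of_eventuallyEq_zero isPreconnected_univ
      (Set.mem_univ _) hev
    have h0 := hall (Set.mem_univ (0 : ℂ))
    rw [_root_.Literature.NumberTheory.LFunctions.riemannXi_zero] at h0
    norm_num at h0
  · -- `ξ` is zero-free on `U`, hence (functional equation) on the whole open strip off the line
    show _root_.RiemannHypothesis
    intro s hzeta htriv hone
    have hxi := _root_.Literature.NumberTheory.LFunctions.riemannXi_eq_zero_of_nontrivial hzeta htriv hone
    obtain ⟨-, h0, h1⟩ :=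
      (_root_.Literature.NumberTheory.LFunctions.riemannXi_eq_zero_iff_holds s).1 hxi
    by_contra hne'
    rcases lt_or_gt_of_ne hne' with hlt | hgt
    · refine hne (1 - s) ⟨?_, ?_⟩
        ((_root_.Literature.NumberTheory.LFunctions.riemannXi_one_sub s).trans hxi)
      · simp only [Complex.sub_re, Complex.one_re]; linarith
      · simp only [Complex.sub_re, Complex.one_re]; linarith
    · exact hne s ⟨hgt, h1⟩ hxi

end Summit.RiemannHypothesis.RiemannHypothesis.Theses.WeilGroundState
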